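import Literature.NumberTheory.Automorphic.KugaLemmaDegreeOne
import HarnessLib

/-!
# The real part of a positive Hermitian form: a real symmetric positive definite bilinear form

Topic `NumberTheory/Automorphic`; namespace `Literature.NumberTheory.Automorphic.Kuga.IsPosForm`
(continues `KugaLemmaDegreeOne`'s bare positive Hermitian forms).  One definition with body and
theorems; no named fact, no `sorry`.

Kuga's lemma in every degree (`Literature.Algebra.Lie.ChevalleyEilenbergKugaAdjoint`,
`d_eq_zero_of_casimirOp_eq_zero`) and the energy argument
(`ChevalleyEilenbergPairedPrimitive.eq_zero_of_pairedPrimitive`) are stated over an ORDERED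
commutative ring `R` with an `R`-bilinear form `B : M →ₗ[R] M →ₗ[R] R` that is symmetric, positive
semidefinite and definite — for the `(𝔤, K)`-complex of a real Lie algebra with values in a complex
space `M` this is `R = ℝ` and `B = Re ⟨ , ⟩` for a positive Hermitian form `⟨ , ⟩` (Petersson ⊗
admissible).  This file performs that passage once and for all:

* `reForm h` — `Re ⟨ , ⟩` as an `ℝ`-bilinear form on the underlying real vector space
  (`reForm_apply`); `reForm_symm`, `reForm_self_nonneg`, `eq_zero_of_reForm_self_eq_zero` — the
  hypotheses `hBs`, `hB`, `hBd` of Kuga's lemma;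
* `reForm_adjoint` — an adjunction `⟨T a, b⟩ = -⟨a, S b⟩` of complex(-or real)-linear operators
  passes to `Re`: the shape of the hypothesis `hadj` (`B ⁅x, a⁆ b = -B a (s x b)`);
  `reForm_skew`, `reForm_selfAdjoint` — the two cases skew-adjoint (`𝔨`, and the Petersson form
  along `𝔤`) and self-adjoint (`𝔭` on an admissible form).

[cite: BorelWallach2000, II §2.2–2.5]

## References

* A. Borel, N. Wallach, *Continuous cohomology, discrete subgroups, and representations of reductive
  groups*, 2nd ed. (2000), II §2.2–2.5 (held). [BorelWallach2000]
-/

noncomputable section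

open scoped ComplexConjugate

namespace Literature.NumberTheory.Automorphic

namespace Kuga

namespace IsPosForm

variable {H : Type*} [AddCommGroup H] [Module ℂ H] {ip : H → H → ℂ} (h : IsPosForm ip)
include h

/-- **`Re ⟨ , ⟩` as a real bilinear form** on the underlying real vector space of `H` (Mathlib's
`Module.complexToReal`, restriction of scalars). [cite: BorelWallach2000, II §2.2] -/
def reForm : H →ₗ[ℝ] H →ₗ[ℝ] ℝ :=
  LinearMap.mk₂ ℝ (fun x y => (ip x y).re)
    (fun x x' y => by rw [h.add_left, Complex.add_re])
    (fun c x y => by rw [← Complex.coe_smul, h.smul_left, Complex.conj_ofReal, Complex.re_ofReal_mul, smul_eq_mul])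
    (fun x y y' => by rw [h.add_right, Complex.add_re])
    (fun c x y => by rw [← Complex.coe_smul, h.smul_right, Complex.re_ofReal_mul, smul_eq_mul])

/-- Unfolding. [folklore] -/
theorem reForm_apply (x y : H) : h.reForm x y = (ip x y).re :=
  rfl

/-- `Re ⟨ , ⟩` is symmetric (hypothesis `hBs` of Kuga's lemma). [folklore] -/
theorem reForm_symm (x y : H) : h.reForm x y = h.reForm y x := by
  rw [reForm_apply, reForm_apply, ← h.conj_symm, Complex.conj_re]

/-- `Re ⟨x, x⟩ ≥ 0` (hypothesis `hB`). [folklore] -/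
theorem reForm_self_nonneg (x : H) : 0 ≤ h.reForm x x :=
  h.nonneg x

/-- `Re ⟨x, x⟩ = 0 ⇒ x = 0` (hypothesis `hBd`). [folklore] -/
theorem eq_zero_of_reForm_self_eq_zero (x : H) (hx : h.reForm x x = 0) : x = 0 :=
  h.eq_zero_of_re_self_eq_zero hx

/-- **Adjunctions pass to `Re`**: if `⟨T a, b⟩ = -⟨a, S b⟩` then `Re ⟨T a, b⟩ = -Re ⟨a, S b⟩` (the
shape of the hypothesis `hadj : B ⁅x, a⁆ b = -B a (s x b)` of Kuga's lemma, with `T = θ(x)`,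
`S = s(x)`). [cite: BorelWallach2000, II 2.2 (4)–(5)] -/
theorem reForm_adjoint {T S : H → H} (hTS : ∀ a b, ip (T a) b = -ip a (S b)) (a b : H) :
    h.reForm (T a) b = -h.reForm a (S b) := by
  rw [reForm_apply, reForm_apply, hTS, Complex.neg_re]

/-- Skew-adjoint operators: `⟨T a, b⟩ = -⟨a, T b⟩ ⇒ Re ⟨T a, b⟩ = -Re ⟨a, T b⟩`. [folklore] -/
theorem reForm_skew {T : H → H} (hT : ∀ a b, ip (T a) b = -ip a (T b)) (a b : H) :
    h.reForm (T a) b = -h.reForm a (T b) :=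
  h.reForm_adjoint hT a b

/-- Self-adjoint operators: `⟨T a, b⟩ = ⟨a, T b⟩ ⇒ Re ⟨T a, b⟩ = Re ⟨a, T b⟩`. [folklore] -/
theorem reForm_selfAdjoint {T : H → H} (hT : ∀ a b, ip (T a) b = ip a (T b)) (a b : H) :
    h.reForm (T a) b = h.reForm a (T b) := by
  rw [reForm_apply, reForm_apply, hT]

/-- A sum `θ = P + Q` of a skew-adjoint `P` and a self-adjoint `Q` has `Re`-adjoint `-(P - Q)`:
`Re ⟨θ a, b⟩ = -Re ⟨a, (P - Q) b⟩` — the case `θ(x) = π(x) ⊗ 1 + 1 ⊗ dE(x)`, `x ∈ 𝔭`, Petersson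
skew and admissible self-adjoint, giving `s(x) = π(x) ⊗ 1 - 1 ⊗ dE(x)`.
[cite: BorelWallach2000, II 2.2 (4)–(5)] -/
theorem reForm_skew_add_selfAdjoint {P Q : H →ₗ[ℂ] H} (hP : ∀ a b, ip (P a) b = -ip a (P b))
    (hQ : ∀ a b, ip (Q a) b = ip a (Q b)) (a b : H) :
    h.reForm ((P + Q) a) b = -h.reForm a ((P - Q) b) := by
  rw [LinearMap.add_apply, LinearMap.sub_apply, map_add, LinearMap.add_apply, map_sub, h.reForm_skew hP,
    h.reForm_selfAdjoint hQ, neg_sub, sub_eq_neg_add]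

end IsPosForm

end Kuga

end Literature.NumberTheory.Automorphic

end
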